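import Summits.FinalStateConjecture.FinalStateConjecture.Theses.PhaseMixingCapture
import Summits.FinalStateConjecture.FinalStateConjecture.Theses.CurvatureOrSymmetry
import Literature.Geometry.Lorentzian.TameGenericityLocal
import Literature.Geometry.Lorentzian.TameGenericityDiagonal

/-!
# Line `Sketch` — SKELETON for crux `WeakCosmicCensorshipTame` (stmt-FinalStateConjecture-17269)

Lead prover's skeleton (session `prover-line-stmt-FinalStateConjecture-17269-0`), built on the
ideator-2 sketch (`Cruxes/WeakCosmicCensorshipTame/SketchIdeator2.lean`, rc 0, 0 sorry).
Composition = card `ray-trichotomy-censored-exit` (§A); card `one-sided-parabolic-escape` (§B) is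
kept as the MECHANISM for the genuine stub (proved reduction
`curvatureRayCensoredExit_of_parabolicAccessAtRays`). `sorry` occurs ONLY in the four `stub_*`
declarations of §C; `WeakCosmicCensorshipTame_of` (§D) concludes the crux BY NAME from them.

* §A  `CurvatureRayCensoredExit` (TameCurvatureModeExit stmt-17347 with the settling conjuncts of
  the exit members DELETED) and the proved reduction
  `weakCosmicCensorshipTame_of_rayTrichotomy :
     MGHDExistence → NoFourthExit → NoVacuumFountains → CurvatureRayCensoredExit →
       PhaseMixingCapture.WeakCosmicCensorshipTame`.
* §B  `parabolic_escape` (proved), `OneSidedParabolicAccessAtRays` and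
  `curvatureRayCensoredExit_of_parabolicAccessAtRays` (proved).
* §C  registered stubs: `stub_mghdExistence` (= item stmt-9937 verbatim; conditional discharge
  from the vendored CBG fact is `Literature…forall_mem_admissibleVacuumData`),
  `stub_noFourthExit` (= stmt-10210 verbatim), `stub_noVacuumFountains` (= stmt-10211 verbatim),
  `stub_curvatureRayCensoredExit` (the genuine stub, lead's).
* §D  `WeakCosmicCensorshipTame_of`.
-/

set_option linter.dupNamespace false
set_option maxHeartbeats 800000

noncomputable section

namespace Summit.FinalStateConjecture.FinalStateConjecture.Cruxes.WeakCosmicCensorshipTame.Sketch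

open Literature.Geometry.Lorentzian
open Summit.FinalStateConjecture.FinalStateConjecture.Theses
open scoped Manifold ContDiff Topology
open Function Filter

/-! ## §A — censored-only exit at visible curvature-blow-up rays -/

/-- **Curvature-ray CENSORED exit** (card `ray-trichotomy-censored-exit`): for every admissible
datum `D` having a maximal vacuum Cauchy development with incomplete `𝓘⁺` which contains a visible
future-incomplete null geodesic with a parallelly-propagated curvature blow-up (alternative (a) of
`CurvatureOrSymmetry.NoFourthExit`, verbatim), there are ONE asymptotically flat end `e`, a tame
(`IsTameDataFamily e 1 F`), immersed-at-`0`, injective admissible one-parameter family `F` through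
`D`, and `ε > 0` such that every member with `0 < ‖c‖ < ε` is CENSORED: it has an MGHD and every
MGHD has complete `𝓘⁺`. This is `CurvatureOrSymmetry.TameCurvatureModeExit` (stmt-17347) with the
Kerr-settling conjuncts of the exit members deleted — strictly weaker. -/
def CurvatureRayCensoredExit : Prop :=
  ∀ (X : Type) [TopologicalSpace X] [ChartedSpace Literature.Geometry.Lorentzian.E3 X] [IsManifold (𝓡 3) ((⊤ : ℕ∞) : WithTop ℕ∞) X] [T2Space X] [SecondCountableTopology X] [ConnectedSpace X], ∀ D ∈ Literature.Geometry.Lorentzian.admissibleVacuumData X, (∃ 𝒟 : Literature.Geometry.Lorentzian.VacuumCauchyDevelopment D, 𝒟.IsMaximal ∧ ¬ Summit.FinalStateConjecture.HasCompleteNullInfinity 𝒟.toCauchyDevelopment ∧ ∀ [𝒟.metric.HasLeviCivita], ∃ (γ : ℝ → 𝒟.carrier) (dom : Set ℝ), (Literature.Geometry.Lorentzian.IsMaximalGeodesicOn 𝒟.metric.leviCivita γ dom ∧ (0 : ℝ) ∈ dom ∧ BddAbove dom ∧ (∀ t ∈ dom, 𝒟.metric.IsNull (Literature.Geometry.Lorentzian.velocity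 (𝓡 4) γ t) ∧ 𝒟.timeOrientation.IsFutureDirected (Literature.Geometry.Lorentzian.velocity (𝓡 4) γ t)) ∧ (∀ t ∈ dom, 0 ≤ t → (∃ (p : X) (δ : ℝ → 𝒟.carrier) (s : Set ℝ), 𝒟.metric.IsNormalisedNullRayFrom 𝒟.timeOrientation 𝒟.embed 𝒟.normal p δ s ∧ ¬ BddAbove s ∧ γ t ∈ 𝒟.metric.chronologicalPast 𝒟.timeOrientation (δ '' (s ∩ Set.Ici 0))))) ∧ (∃ e : Fin 4 → (Π t : ℝ, TangentSpace (𝓡 4) (γ t)), (∀ a, ∀ t ∈ dom, MDifferentiableAt 𝓘(ℝ, ℝ) (𝓡 4).tangent (fun s : ℝ ↦ (Bundle.TotalSpace.mk' Literature.Geometry.Lorentzian.E4 (γ s) (e a s) : TangentBundle (𝓡 4) 𝒟.carrier)) t ∧ Literature.Geometry.Lorentzian.covariantDerivAlong 𝒟.metric.leviCivita γ (e a) t = 0) ∧ LinearIndependent ℝ (fun a ↦ e a 0) ∧ ∀ C : ℝ, ∃ t ∈ dom, 0 ≤ t ∧ ∃ a b c d : Fin 4, C < |𝒟.metric.val (γ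 t) (CovariantDerivative.curvature 𝒟.metric.leviCivita (γ t) (e a t) (e b t) (e c t)) (e d t)|)) → ∃ (e : Literature.Geometry.Lorentzian.AFEnd X) (F : EuclideanSpace ℝ (Fin 1) → Literature.Geometry.Lorentzian.InitialDataSet (𝓡 3) X), Literature.Geometry.Lorentzian.InitialDataSet.IsTameDataFamily e 1 F ∧ Literature.Geometry.Lorentzian.InitialDataSet.IsImmersedAtZero 1 F ∧ F 0 = D ∧ Function.Injective F ∧ (∀ c, F c ∈ Literature.Geometry.Lorentzian.admissibleVacuumData X) ∧ ∃ ε : ℝ, 0 < ε ∧ ∀ c, c ≠ 0 → ‖c‖ < ε → ((∃ 𝒟 : Literature.Geometry.Lorentzian.VacuumCauchyDevelopment (F c), 𝒟.IsMaximal) ∧ ∀ 𝒟 : Literature.Geometry.Lorentzian.VacuumCauchyDevelopment (F c), 𝒟.IsMaximal → Summit.FinalStateConjecture.HasCompleteNullInfinity 𝒟.toCauchyDevelopment)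

/-! ## §B — one-sided parabolic escape -/

section Parabola

variable {X : Type*} [TopologicalSpace X] [ChartedSpace E3 X] [IsManifold (𝓡 3) ∞ X]

/-- The parabola `c ↦ (-(|K|+1) c², c)` of the parameter plane, as a map of Euclidean spaces. -/
def parabola (K : ℝ) (c : EuclideanSpace ℝ (Fin 1)) : EuclideanSpace ℝ (Fin 2) :=
  (-(|K| + 1) * (c 0) ^ 2) • EuclideanSpace.single (0 : Fin 2) (1 : ℝ) +
    (c 0) • EuclideanSpace.single (1 : Fin 2) (1 : ℝ)

omit [TopologicalSpace X] [ChartedSpace E3 X] [IsManifold (𝓡 3) ∞ X] in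
lemma parabola_apply_zero (K : ℝ) (c : EuclideanSpace ℝ (Fin 1)) :
    parabola K c 0 = -(|K| + 1) * (c 0) ^ 2 := by
  simp [parabola]

omit [TopologicalSpace X] [ChartedSpace E3 X] [IsManifold (𝓡 3) ∞ X] in
lemma parabola_apply_one (K : ℝ) (c : EuclideanSpace ℝ (Fin 1)) :
    parabola K c 1 = c 0 := by
  simp [parabola]

omit [TopologicalSpace X] [ChartedSpace E3 X] [IsManifold (𝓡 3) ∞ X] in
lemma parabola_zero (K : ℝ) : parabola K 0 = 0 := by
  ext i
  fin_cases i <;> simp [parabola]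

omit [TopologicalSpace X] [ChartedSpace E3 X] [IsManifold (𝓡 3) ∞ X] in
lemma contDiff_parabola (K : ℝ) : ContDiff ℝ ∞ (parabola K) := by
  have h0 : ContDiff ℝ ∞ (fun c : EuclideanSpace ℝ (Fin 1) ↦ c 0) :=
    (EuclideanSpace.proj (0 : Fin 1) : EuclideanSpace ℝ (Fin 1) →L[ℝ] ℝ).contDiff
  unfold parabola
  exact ((contDiff_const.mul (h0.pow 2)).smul contDiff_const).add (h0.smul contDiff_const)

omit [TopologicalSpace X] [ChartedSpace E3 X] [IsManifold (𝓡 3) ∞ X] in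
lemma injective_parabola (K : ℝ) : Injective (parabola K) := by
  intro c c' h
  have h1 : parabola K c 1 = parabola K c' 1 := by rw [h]
  rw [parabola_apply_one, parabola_apply_one] at h1
  ext i
  fin_cases i
  simpa using h1

omit [TopologicalSpace X] [ChartedSpace E3 X] [IsManifold (𝓡 3) ∞ X] in
/-- The differential of the parabola at `0` is injective (its second component is the identity
coordinate). -/
lemma injective_fderiv_parabola (K : ℝ) : Injective (fderiv ℝ (parabola K) 0) := by
  -- derivative of the coordinate `c ↦ c 0`
  have h0 : HasFDerivAt (fun c : EuclideanSpace ℝ (Fin 1) ↦ c 0)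
      (EuclideanSpace.proj (0 : Fin 1) : EuclideanSpace ℝ (Fin 1) →L[ℝ] ℝ) 0 :=
    (EuclideanSpace.proj (0 : Fin 1) : EuclideanSpace ℝ (Fin 1) →L[ℝ] ℝ).hasFDerivAt
  have hq := (h0.pow 2).const_mul (-(|K| + 1))
  have hφ : HasFDerivAt (parabola K) _ 0 :=
    (hq.smul_const (EuclideanSpace.single (0 : Fin 2) (1 : ℝ))).add
      (h0.smul_const (EuclideanSpace.single (1 : Fin 2) (1 : ℝ)))
  rw [hφ.fderiv]
  intro v w hvw
  have h1 := congrArg (fun z : EuclideanSpace ℝ (Fin 2) ↦ z 1) hvw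
  simp at h1
  ext i
  fin_cases i
  simpa using h1

/-- **Parabolic escape** (card `one-sided-parabolic-escape`, first lemma, PROVED). Let `G` be a
tame (`IsTameDataFamily e 2 G`), immersed-at-`0`, injective two-parameter family of `𝓓`-data, and
suppose ONE-SIDED goodness on an open parabolic horn of the parameter plane: every `G p` with
`‖p‖ < ε` and `p₀ < -K·p₁²` has `P`. Then the curve `c ↦ G(-( |K|+1) c², c)` is tame on the same
end, passes through `G 0` at `c = 0`, is injective and immersed at `0`, and after the radial
reparametrisation ALL its members off `0` have `P`. No goodness is asked on the other side of the
horn's vertex: a naked datum on the EDGE of a single certified basin escapes by grazing the edge. -/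
theorem parabolic_escape {𝓓 : Set (InitialDataSet (𝓡 3) X)} {P : InitialDataSet (𝓡 3) X → Prop}
    {e : AFEnd X} {G : EuclideanSpace ℝ (Fin 2) → InitialDataSet (𝓡 3) X}
    (hG : InitialDataSet.IsTameDataFamily e 2 G) (himm : InitialDataSet.IsImmersedAtZero 2 G)
    (hinj : Injective G) (h𝓓 : ∀ p, G p ∈ 𝓓) {K ε : ℝ} (hε : 0 < ε)
    (hP : ∀ p : EuclideanSpace ℝ (Fin 2), ‖p‖ < ε → p 0 < -K * (p 1) ^ 2 → P (G p)) :
    ∃ F : EuclideanSpace ℝ (Fin 1) → InitialDataSet (𝓡 3) X,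
      InitialDataSet.IsTameDataFamily e 1 F ∧ F 0 = G 0 ∧ Injective F ∧
        InitialDataSet.IsImmersedAtZero 1 F ∧ (∀ c, F c ∈ 𝓓) ∧ ∀ c ≠ 0, P (F c) := by
  -- the raw parabola curve
  set F₀ : EuclideanSpace ℝ (Fin 1) → InitialDataSet (𝓡 3) X := fun c ↦ G (parabola K c) with hF₀
  have htame : InitialDataSet.IsTameDataFamily e 1 F₀ :=
    hG.comp_contDiff (contDiff_parabola K) (parabola_zero K)
  have himm₀ : InitialDataSet.IsImmersedAtZero 1 F₀ :=
    himm.comp_of_injective_fderiv (parabola_zero K)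
      ((contDiff_parabola K).differentiable (by simp) 0) (injective_fderiv_parabola K)
  have hinj₀ : Injective F₀ := hinj.comp (injective_parabola K)
  -- members of the parabola near `0`, off `0`, lie in the horn
  have hcont : Continuous (parabola K) := (contDiff_parabola K).continuous
  have hnhds : ∀ᶠ c in 𝓝 (0 : EuclideanSpace ℝ (Fin 1)), ‖parabola K c‖ < ε := by
    have : Tendsto (fun c ↦ ‖parabola K c‖) (𝓝 0) (𝓝 ‖parabola K 0‖) :=
      (continuous_norm.comp hcont).tendsto 0
    rw [parabola_zero, norm_zero] at this
    exact this.eventually (gt_mem_nhds hε)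
  obtain ⟨δ, hδ, hball⟩ := Metric.eventually_nhds_iff.1 hnhds
  have hgood : ∀ c : EuclideanSpace ℝ (Fin 1), c ≠ 0 → ‖c‖ < δ → P (F₀ c) := by
    intro c hc hcδ
    have hc0 : c 0 ≠ 0 := by
      intro h
      apply hc
      ext i
      fin_cases i
      simpa using h
    refine hP _ (hball (by simpa [dist_eq_norm] using hcδ)) ?_
    rw [parabola_apply_zero, parabola_apply_one]
    have hsq : 0 < (c 0) ^ 2 := by positivity
    nlinarith [abs_nonneg K, le_abs_self K, neg_abs_le K]
  obtain ⟨F, hF, hF0, hinjF, himmF, h𝓓F, hPF⟩ :=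
    InitialDataSet.exists_tameFamily_of_local (𝓓 := 𝓓) (P := P) htame himm₀ hinj₀
      (fun c ↦ h𝓓 _) hδ hgood
  refine ⟨F, hF, ?_, hinjF, himmF, h𝓓F, hPF⟩
  rw [hF0, hF₀]
  simp only [parabola_zero]

end Parabola

/-- **One-sided parabolic access AT CURVATURE RAYS** (local form, composing with §A): the same
conclusion, asked only of data carrying the handle of `CurvatureRayCensoredExit` (an MGHD with
incomplete `𝓘⁺` and a visible future-incomplete null geodesic with a p.p. curvature blow-up). -/
def OneSidedParabolicAccessAtRays : Prop :=
  ∀ (X : Type) [TopologicalSpace X] [ChartedSpace Literature.Geometry.Lorentzian.E3 X] [IsManifold (𝓡 3) ((⊤ : ℕ∞) : WithTop ℕ∞) X] [T2Space X] [SecondCountableTopology X] [ConnectedSpace X], ∀ D ∈ Literature.Geometry.Lorentzian.admissibleVacuumData X, (∃ 𝒟 : Literature.Geometry.Lorentzian.VacuumCauchyDevelopment D, 𝒟.IsMaximal ∧ ¬ Summit.FinalStateConjecture.HasCompleteNullInfinity 𝒟.toCauchyDevelopment ∧ ∀ [𝒟.metric.HasLeviCivita], ∃ (γ : ℝ → 𝒟.carrier)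 (dom : Set ℝ), (Literature.Geometry.Lorentzian.IsMaximalGeodesicOn 𝒟.metric.leviCivita γ dom ∧ (0 : ℝ) ∈ dom ∧ BddAbove dom ∧ (∀ t ∈ dom, 𝒟.metric.IsNull (Literature.Geometry.Lorentzian.velocity (𝓡 4) γ t) ∧ 𝒟.timeOrientation.IsFutureDirected (Literature.Geometry.Lorentzian.velocity (𝓡 4) γ t)) ∧ (∀ t ∈ dom, 0 ≤ t → (∃ (p : X) (δ : ℝ → 𝒟.carrier) (s : Set ℝ), 𝒟.metric.IsNormalisedNullRayFrom 𝒟.timeOrientation 𝒟.embed 𝒟.normal p δ s ∧ ¬ BddAbove s ∧ γ t ∈ 𝒟.metric.chronologicalPast 𝒟.timeOrientation (δ '' (s ∩ Set.Ici 0))))) ∧ (∃ e : Fin 4 → (Π t : ℝ, TangentSpace (𝓡 4) (γ t)), (∀ a, ∀ t ∈ dom, MDifferentiableAt 𝓘(ℝ, ℝ) (𝓡 4).tangent (fun s : ℝ ↦ (Bundle.TotalSpace.mk' Literature.Geometry.Lorentzian.E4 (γ s) (e a s) : TangentBundle (𝓡 4) 𝒟.carrier)) t ∧ Literature.Geometry.Lorentzian.covariantDerivAlong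 𝒟.metric.leviCivita γ (e a) t = 0) ∧ LinearIndependent ℝ (fun a ↦ e a 0) ∧ ∀ C : ℝ, ∃ t ∈ dom, 0 ≤ t ∧ ∃ a b c d : Fin 4, C < |𝒟.metric.val (γ t) (CovariantDerivative.curvature 𝒟.metric.leviCivita (γ t) (e a t) (e b t) (e c t)) (e d t)|)) → ∃ (e : Literature.Geometry.Lorentzian.AFEnd X) (G : EuclideanSpace ℝ (Fin 2) → Literature.Geometry.Lorentzian.InitialDataSet (𝓡 3) X), Literature.Geometry.Lorentzian.InitialDataSet.IsTameDataFamily e 2 G ∧ Literature.Geometry.Lorentzian.InitialDataSet.IsImmersedAtZero 2 G ∧ G 0 = D ∧ Function.Injective G ∧ (∀ p, G p ∈ Literature.Geometry.Lorentzian.admissibleVacuumData X) ∧ ∃ K ε : ℝ, 0 < ε ∧ ∀ p : EuclideanSpace ℝ (Fin 2), ‖p‖ < ε → p 0 < -K * (p 1) ^ 2 → ((∃ 𝒟 : Literature.Geometry.Lorentzian.VacuumCauchyDevelopment (G p), 𝒟.IsMaximal) ∧ ∀ 𝒟 : Literature.Geometry.Lorentzian.VacuumCauchyDevelopment (G p),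 𝒟.IsMaximal → Summit.FinalStateConjecture.HasCompleteNullInfinity 𝒟.toCauchyDevelopment)

/-- The censored-only curvature-ray exit follows from parabolic access at curvature rays
(PROVED); with `weakCosmicCensorshipTame_of_rayTrichotomy` this closes W from the all-data
trichotomy items of CurvatureOrSymmetry plus ONE one-sided dynamical statement. -/
theorem curvatureRayCensoredExit_of_parabolicAccessAtRays (h : OneSidedParabolicAccessAtRays) :
    CurvatureRayCensoredExit := by
  intro X _ _ _ _ _ _ D hD hhandle
  obtain ⟨e, G, hG, himm, h0, hinj, hadm, K, ε, hε, hgood⟩ := h X D hD hhandle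
  obtain ⟨F, hF, hF0, hinjF, himmF, h𝓓F, hPF⟩ :=
    parabolic_escape (𝓓 := admissibleVacuumData X)
      (P := fun D ↦ (∃ 𝒟 : VacuumCauchyDevelopment D, 𝒟.IsMaximal) ∧
        ∀ 𝒟 : VacuumCauchyDevelopment D, 𝒟.IsMaximal →
          Summit.FinalStateConjecture.HasCompleteNullInfinity 𝒟.toCauchyDevelopment)
      hG himm hinj hadm (K := K) hε hgood
  exact ⟨e, F, hF, himmF, hF0.trans h0, hinjF, h𝓓F, 1, one_pos, fun c hc _ ↦ hPF c hc⟩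

/-! ## §C — registered stubs (the ONLY `sorry`s of this file) -/

/-- **Stub 1 — MGHD existence** (verbatim `CurvatureOrSymmetry.MGHDExistence`, item
stmt-FinalStateConjecture-9937, shared by every route of the summit): every admissible datum has a
maximal vacuum Cauchy development. Choquet-Bruhat–Geroch 1969, Thm. 3; Sbierski 2016, Thm. 2.6. In
the tree: conditional discharge `Literature.Geometry.Lorentzian.forall_mem_admissibleVacuumData`
from the undischarged named fact `choquetBruhat_geroch_exists_mghd_cauchy` (XL). -/
theorem stub_mghdExistence : CurvatureOrSymmetry.MGHDExistence := by
  sorry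

/-- **Stub 2 — no fourth exit** (verbatim `CurvatureOrSymmetry.NoFourthExit`, item
stmt-FinalStateConjecture-10210, all data, no genericity): incomplete `𝓘⁺` of an MGHD of admissible
data is witnessed by a VISIBLE future-incomplete null geodesic ending (a) in a parallelly-propagated
curvature blow-up or (c) in a local null Killing symmetry. -/
theorem stub_noFourthExit : CurvatureOrSymmetry.NoFourthExit := by
  sorry

/-- **Stub 3 — no vacuum fountains** (verbatim `CurvatureOrSymmetry.NoVacuumFountains`, item
stmt-FinalStateConjecture-10211, all data): alternative (c) without (a) never occurs in an MGHD of
one-ended asymptotically flat admissible vacuum data. -/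
theorem stub_noVacuumFountains : CurvatureOrSymmetry.NoVacuumFountains := by
  sorry

/-- **Stub 4 — the censored-only curvature-ray exit** (the genuine stub of the line, lead's;
`CurvatureRayCensoredExit` of §A = `CurvatureOrSymmetry.TameCurvatureModeExit` stmt-17347 with the
Kerr-settling conjuncts deleted, hence implied by it a fortiori; mechanism offered by §B:
`curvatureRayCensoredExit_of_parabolicAccessAtRays`). Content: instability of visible
curvature-blow-up naked singularities in the smooth TAME class (Christodoulou, Ann. Math. 149 (1999)
in symmetry; open for 3+1 vacuum). -/
theorem stub_curvatureRayCensoredExit : CurvatureRayCensoredExit := by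
  sorry

/-! ## §D — composition: the crux BY NAME from the stubs -/

/-- **Composition of line `Sketch`**: the four registered stubs give the crux
`PhaseMixingCapture.WeakCosmicCensorshipTame` — pure logic over
`InitialDataSet.isTameChristodoulouGeneric_of_local`: at a W-exceptional admissible datum, MGHD
existence (stub 1) leaves an MGHD with incomplete `𝓘⁺`; no-fourth-exit (stub 2) gives a visible
incomplete null geodesic ending in curvature (a) or a local null Killing symmetry (c); no-fountains
(stub 3) excludes (c) without (a); the censored-only curvature-ray exit (stub 4) is the tame local
escape. (Hypothetical form: `weakCosmicCensorshipTame_of_rayTrichotomy` of the ideator sketch / the lead's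
helper file `RayTrichotomyReduction.lean`.) -/
theorem WeakCosmicCensorshipTame_of : PhaseMixingCapture.WeakCosmicCensorshipTame := by
  intro X _ _ _ _ _ _
  refine InitialDataSet.isTameChristodoulouGeneric_of_local fun D hD hnot ↦ ?_
  have hex : ∃ 𝒟 : VacuumCauchyDevelopment D, 𝒟.IsMaximal := stub_mghdExistence X D hD
  have hbad : ∃ 𝒟 : VacuumCauchyDevelopment D, 𝒟.IsMaximal ∧
      ¬ Summit.FinalStateConjecture.HasCompleteNullInfinity 𝒟.toCauchyDevelopment := by
    by_contra h
    push Not at h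
    exact hnot ⟨hex, h⟩
  obtain ⟨𝒟, hmax, hnc⟩ := hbad
  obtain ⟨e, Fam, htame, himm, h0, hinj, hadm, ε, hε, hgood⟩ :=
    stub_curvatureRayCensoredExit X D hD ⟨𝒟, hmax, hnc, by
      intro inst
      obtain ⟨γ, dom, hstuff, hac⟩ := stub_noFourthExit X D hD 𝒟 hmax hnc
      rcases hac with ha | hc
      · exact ⟨γ, dom, hstuff, ha⟩
      · exact ⟨γ, dom, hstuff, Classical.byContradiction fun hna ↦
          stub_noVacuumFountains X D hD 𝒟 hmax ⟨γ, dom, hstuff, hna, hc⟩⟩⟩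
  exact ⟨e, Fam, htame, himm, h0, hinj, hadm, ε, hε, fun c hc hcε ↦ hgood c hc hcε⟩

end Summit.FinalStateConjecture.FinalStateConjecture.Cruxes.WeakCosmicCensorshipTame.Sketch

end
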